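import Mathlib
import HarnessLib
import Summits.Ventures.LatticeQCDFlow.Scoring.IMHWeightBlindTau

/-!
# The level decomposition of the exact flow-MCMC (IMH) chain's autocovariance:
# `C_f(t) = C^{W}_{μ_f}(t) + E_p[v_f(W) · (1 − a(W))ᵗ]`

HONEST FRAMING: exact (Metropolis-corrected) sampling algorithms for lattice gauge theory;
figures of merit are autocorrelation/cost numbers at stated couplings and volumes; no
continuum-physics claim.

Venture `LatticeQCDFlow` (cell pub-lqcd), topic `Scoring`; FANOUT row 8 (`s0-cpn-nemc`, GEN-10).
NEW WORK of the cell (elementary finite sums), not a published result; it completes the typing of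
statement (T3) of the flow seat's `HOME/canary-flow/imhlaw/IMH-LAW-flow.md` — the sentence the GEN-9
file `IMHWeightBlindTau.lean` left as markdown: "For a general `f = μ_f(w) + ε` the law adds
`Cov(μ_f(W_0), μ_f(W_t))` and weights the holding term by the conditional variance `v_f(w)`" — on
the tree's objects `Exactness.imhKernel`, `Scoring.imhMatrix · twoTime · mv · liuG`; nothing is cited
as a fact and no definition is added (the move-acceptance `a(x)` is written `1 − liuG p q x x` as in
`IMHPoissonTransfer.lean`).  The windowless / windowed `τ` consequences are the companion file
`Scoring/IMHLevelDecompositionTau.lean`.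

## Setting (as in `IMHWeightBlindTau.lean`)

A finite product state space `L × Y` ('level' × 'label'): target `p (l, y) = pL l · μ y` and model
`q (l, y) = qL l · μ y` share the label law `μ` (`μ > 0`, `Σ μ = 1`), so the weight `w = pL/qL` is a
function of the level.  For ANY observable `f : L × Y → ℝ` write `φ l := Σ_y μ y · f (l, y)` (the
level mean, `μ_f(w)`) and `ε := f − φ ∘ fst` (the residual, `Σ_y μ y · ε (l, y) = 0` at every level,
`levelMean_resid_centred`); `v l := Σ_y μ y · ε (l, y)²` is the conditional variance `v_f(w)`.

## Content

* `imh_mv_eq_add_sum_min` (any finite space) — the exact chain acts through acceptance-weighted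
  DIFFERENCES: `(K h)(x) = h x + Σ_z min(q z, p z q x / p x) · (h z − h x)`.
* `level_mv`, `level_mv_pow` — THE WEIGHT PROCESS IS ITSELF THE IMH CHAIN WITH THE SAME `a(·)`:
  a level function evolves by the level chain, `Kᵗ (φ ∘ fst) = (K_Lᵗ φ) ∘ fst` with
  `K_L = imhMatrix pL qL`.
* `resid_mv_pow` — a level-wise centred residual evolves diagonally, `Kᵗ ε = (1 − a)ᵗ · ε`
  (generalising `blind_mv_pow`, where `ε = φ ⊗ g`).
* `twoTime_level`, `twoTime_level_resid`, `twoTime_resid_level`, `twoTime_resid` — the four blocks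
  of the two-time form: level/level is the level chain's, the cross terms VANISH, and
  residual/residual is `Σ_l pL l · (1 − a l)ᵗ · v l`.
* **`twoTime_level_add_resid`**, **`twoTime_level_decomposition`** — (T3), general form, for EVERY
  `f`: `S_t(f, f) = S^L_t(φ, φ) + Σ_l pL l · (liuG pL qL l l)ᵗ · v l`, i.e.
  `C_f(t) + (p f)² = [C^{W}_{μ_f}(t) + (p f)²] + E_p[v_f(W) (1 − a(W))ᵗ]` — "the law adds
  `Cov(μ_f(W_0), μ_f(W_t))` and weights the holding term by `v_f`".

Reading (markdown, not a claim beyond the statements): on the empirical pool of a chain file every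
atom carries its own `f` value, so the flow seat's atom computation (T2)/(T4) contains this
decomposition automatically (their remark); the typed form says which two numbers a weight-blindness
test compares — the level-mean autocovariance under the weight chain and the `v`-weighted rejection
probabilities.
-/


namespace Summit.Ventures.LatticeQCDFlow.Scoring

open Finset Literature.Probability.MarkovChains Summit.Ventures.LatticeQCDFlow.Exactness

/-! ### Any finite space -/

section AnySpace

variable {X : Type*} [Fintype X] [DecidableEq X]

omit [DecidableEq X] in
/-- `mv` is additive in the vector: `M (f + g) = M f + M g`. -/
theorem mv_add (M : Matrix X X ℝ) (f g : X → ℝ) : mv M (f + g) = mv M f + mv M g := by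
  funext x
  simp only [mv, Pi.add_apply, mul_add, sum_add_distrib]

/-- The two-time form of a sum: `S_t(f+g, f+g) = S_t(f,f) + S_t(f,g) + S_t(g,f) + S_t(g,g)`. -/
theorem twoTime_add_add (p : X → ℝ) (M : Matrix X X ℝ) (t : ℕ) (f g : X → ℝ) :
    twoTime p M t (f + g) (f + g)
      = twoTime p M t f f + twoTime p M t f g + twoTime p M t g f + twoTime p M t g g := by
  simp only [twoTime, mv_add, Pi.add_apply, mul_add, add_mul, sum_add_distrib]
  ring

/-- **The exact flow-MCMC chain acts through acceptance-weighted differences**: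
`(K h)(x) = h x + Σ_z min(q z, p z q x / p x) · (h z − h x)` (rows of `K` sum to one; the `z = x`
term of the sum vanishes). -/
theorem imh_mv_eq_add_sum_min (p q h : X → ℝ) (x : X) :
    mv (imhMatrix p q) h x = h x + ∑ z, min (q z) (p z * q x / p x) * (h z - h x) := by
  have hrow : ∑ z, imhKernel p q x z = 1 := mhKernel_sum_eq_one _ _ x
  have h1 : mv (imhMatrix p q) h x = h x + ∑ z, imhKernel p q x z * (h z - h x) := by
    have h2 : ∑ z, imhKernel p q x z * (h z - h x)
        = ∑ z, imhKernel p q x z * h z - (∑ z, imhKernel p q x z) * h x := by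
      rw [sum_mul, ← sum_sub_distrib]
      exact sum_congr rfl fun z _ => by ring
    rw [h2, hrow, one_mul]
    simp only [mv, imhMatrix_apply]
    ring
  rw [h1, ← add_sum_erase _ (fun z => imhKernel p q x z * (h z - h x)) (mem_univ x),
    ← add_sum_erase _ (fun z => min (q z) (p z * q x / p x) * (h z - h x)) (mem_univ x)]
  simp only [sub_self, mul_zero, zero_add]
  congr 1
  refine sum_congr rfl fun z hz => ?_
  unfold imhKernel
  rw [mhKernel_of_ne (ne_of_mem_erase hz)]
  rfl

end AnySpace

/-! ### The product space `level × label`: the level mean and the residual -/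

section Level

variable {L Y : Type*} [Fintype L] [DecidableEq L] [Fintype Y] [DecidableEq Y]
variable {pL qL : L → ℝ} {μ : Y → ℝ}

omit [Fintype L] [DecidableEq L] [DecidableEq Y] in
/-- The residual of an observable about its level mean is centred at every level:
`Σ_y μ y · (f (l, y) − Σ_{y'} μ y' f (l, y')) = 0` (`Σ μ = 1`). -/
theorem levelMean_resid_centred (hμ1 : ∑ y, μ y = 1) (f : L × Y → ℝ) (l : L) :
    ∑ y, μ y * (f (l, y) - ∑ y', μ y' * f (l, y')) = 0 := by
  simp only [mul_sub, sum_sub_distrib, ← sum_mul, hμ1, one_mul, sub_self]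

/-- **The weight process is the IMH chain with the same acceptance**: a level function evolves by
the level chain, `(K (φ ∘ fst)) (l, y) = (K_L φ) l` with `K_L = imhMatrix pL qL`. -/
theorem level_mv (hpL : ∀ l, 0 < pL l) (hμ : ∀ y, 0 < μ y) (hμ1 : ∑ y, μ y = 1) (φ : L → ℝ) :
    mv (imhMatrix (fun z : L × Y => pL z.1 * μ z.2) (fun z => qL z.1 * μ z.2)) (fun z => φ z.1)
      = fun z => mv (imhMatrix pL qL) φ z.1 := by
  funext x
  have h1 : mv (imhMatrix (fun z : L × Y => pL z.1 * μ z.2) (fun z => qL z.1 * μ z.2))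
      (fun z => φ z.1) x = φ x.1 + ∑ z : L × Y,
        min (qL z.1 * μ z.2) (pL z.1 * μ z.2 * (qL x.1 * μ x.2) / (pL x.1 * μ x.2))
          * (φ z.1 - φ x.1) :=
    imh_mv_eq_add_sum_min _ _ _ x
  rw [h1, imh_mv_eq_add_sum_min pL qL φ x.1]
  congr 1
  simp_rw [blind_min_eq hpL hμ x]
  rw [Fintype.sum_prod_type]
  refine sum_congr rfl fun l' _ => ?_
  have h : ∀ y, μ (l', y).2 * min (qL (l', y).1) (pL (l', y).1 * qL x.1 / pL x.1)
      * (φ (l', y).1 - φ x.1) = μ y * (min (qL l') (pL l' * qL x.1 / pL x.1) * (φ l' - φ x.1)) :=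
    fun y => by ring
  rw [sum_congr rfl fun y _ => h y, ← sum_mul, hμ1, one_mul]

/-- … and so do its iterates: `Kᵗ (φ ∘ fst) = (K_Lᵗ φ) ∘ fst`. -/
theorem level_mv_pow (hpL : ∀ l, 0 < pL l) (hμ : ∀ y, 0 < μ y) (hμ1 : ∑ y, μ y = 1) :
    ∀ (t : ℕ) (φ : L → ℝ),
    mv (imhMatrix (fun z : L × Y => pL z.1 * μ z.2) (fun z => qL z.1 * μ z.2) ^ t) (fun z => φ z.1)
      = fun z => mv (imhMatrix pL qL ^ t) φ z.1 := by
  intro t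
  induction t with
  | zero => intro φ; funext z; simp [mv_one]
  | succ t ih =>
    intro φ
    rw [pow_succ, mv_mul, level_mv hpL hμ hμ1 φ, ih (mv (imhMatrix pL qL) φ), pow_succ, mv_mul]

omit [DecidableEq L] [DecidableEq Y] in
/-- A level-wise centred residual is invisible to the acceptance average:
`Σ_z min(q z, p z q x / p x) · ε z = 0`. -/
theorem resid_rate_sum_eq_zero (hpL : ∀ l, 0 < pL l) (hμ : ∀ y, 0 < μ y) {ε : L × Y → ℝ}
    (hε : ∀ l, ∑ y, μ y * ε (l, y) = 0) (x : L × Y) :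
    ∑ z : L × Y, min (qL z.1 * μ z.2) (pL z.1 * μ z.2 * (qL x.1 * μ x.2) / (pL x.1 * μ x.2))
      * ε z = 0 := by
  simp_rw [blind_min_eq hpL hμ x]
  rw [Fintype.sum_prod_type]
  refine sum_eq_zero fun l' _ => ?_
  have h : ∀ y, μ (l', y).2 * min (qL (l', y).1) (pL (l', y).1 * qL x.1 / pL x.1) * ε (l', y)
      = min (qL l') (pL l' * qL x.1 / pL x.1) * (μ y * ε (l', y)) := fun y => by ring
  rw [sum_congr rfl fun y _ => h y, ← mul_sum, hε l', mul_zero]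

/-- **`Kᵗ ε = (1 − a)ᵗ · ε`** for a level-wise centred residual: the exact chain multiplies it by
the rejection probability `liuG pL qL l l = 1 − a(l)` of its level, step after step. -/
theorem resid_mv_pow (hpL : ∀ l, 0 < pL l) (hμ : ∀ y, 0 < μ y) (hμ1 : ∑ y, μ y = 1)
    {ε : L × Y → ℝ} (hε : ∀ l, ∑ y, μ y * ε (l, y) = 0) : ∀ t : ℕ,
    mv (imhMatrix (fun z : L × Y => pL z.1 * μ z.2) (fun z => qL z.1 * μ z.2) ^ t) ε
      = fun z => liuG pL qL z.1 z.1 ^ t * ε z := by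
  intro t
  induction t with
  | zero => funext z; simp [mv_one]
  | succ t ih =>
    rw [pow_succ', mv_mul, ih]
    funext x
    have hε' : ∀ l, ∑ y, μ y * (liuG pL qL (l, y).1 (l, y).1 ^ t * ε (l, y)) = 0 := by
      intro l
      have h : ∀ y, μ y * (liuG pL qL (l, y).1 (l, y).1 ^ t * ε (l, y))
          = liuG pL qL l l ^ t * (μ y * ε (l, y)) := fun y => by ring
      rw [sum_congr rfl fun y _ => h y, ← mul_sum, hε l, mul_zero]
    have h := imh_mv_eq_liuG_diag_mul (p := fun z : L × Y => pL z.1 * μ z.2)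
      (q := fun z => qL z.1 * μ z.2) (fun z => mul_pos (hpL z.1) (hμ z.2))
      (fun z => liuG pL qL z.1 z.1 ^ t * ε z)
      (fun x => resid_rate_sum_eq_zero hpL hμ hε' x) x
    rw [h, blind_liuG_diag hpL hμ hμ1 x]
    ring

/-! ### The four blocks of the two-time form -/

/-- Level/level: `S_t(φ ∘ fst, ψ ∘ fst) = S^L_t(φ, ψ)` — the level chain's own two-time form. -/
theorem twoTime_level (hpL : ∀ l, 0 < pL l) (hμ : ∀ y, 0 < μ y) (hμ1 : ∑ y, μ y = 1)
    (φ ψ : L → ℝ) (t : ℕ) :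
    twoTime (fun z : L × Y => pL z.1 * μ z.2)
        (imhMatrix (fun z : L × Y => pL z.1 * μ z.2) (fun z => qL z.1 * μ z.2)) t
        (fun z => φ z.1) (fun z => ψ z.1)
      = twoTime pL (imhMatrix pL qL) t φ ψ := by
  unfold twoTime
  rw [level_mv_pow hpL hμ hμ1 t ψ, Fintype.sum_prod_type]
  refine sum_congr rfl fun l _ => ?_
  have h : ∀ y, pL (l, y).1 * μ (l, y).2 * φ (l, y).1 * mv (imhMatrix pL qL ^ t) ψ (l, y).1
      = μ y * (pL l * φ l * mv (imhMatrix pL qL ^ t) ψ l) := fun y => by ring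
  rw [sum_congr rfl fun y _ => h y, ← sum_mul, hμ1, one_mul]

/-- Level/residual: `S_t(φ ∘ fst, ε) = 0`. -/
theorem twoTime_level_resid (hpL : ∀ l, 0 < pL l) (hμ : ∀ y, 0 < μ y) (hμ1 : ∑ y, μ y = 1)
    (φ : L → ℝ) {ε : L × Y → ℝ} (hε : ∀ l, ∑ y, μ y * ε (l, y) = 0) (t : ℕ) :
    twoTime (fun z : L × Y => pL z.1 * μ z.2)
        (imhMatrix (fun z : L × Y => pL z.1 * μ z.2) (fun z => qL z.1 * μ z.2)) t
        (fun z => φ z.1) ε = 0 := by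
  unfold twoTime
  rw [resid_mv_pow hpL hμ hμ1 hε t, Fintype.sum_prod_type]
  refine sum_eq_zero fun l _ => ?_
  have h : ∀ y, pL (l, y).1 * μ (l, y).2 * φ (l, y).1 * (liuG pL qL (l, y).1 (l, y).1 ^ t * ε (l, y))
      = pL l * φ l * liuG pL qL l l ^ t * (μ y * ε (l, y)) := fun y => by ring
  rw [sum_congr rfl fun y _ => h y, ← mul_sum, hε l, mul_zero]

/-- Residual/level: `S_t(ε, φ ∘ fst) = 0`. -/
theorem twoTime_resid_level (hpL : ∀ l, 0 < pL l) (hμ : ∀ y, 0 < μ y) (hμ1 : ∑ y, μ y = 1)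
    {ε : L × Y → ℝ} (hε : ∀ l, ∑ y, μ y * ε (l, y) = 0) (φ : L → ℝ) (t : ℕ) :
    twoTime (fun z : L × Y => pL z.1 * μ z.2)
        (imhMatrix (fun z : L × Y => pL z.1 * μ z.2) (fun z => qL z.1 * μ z.2)) t
        ε (fun z => φ z.1) = 0 := by
  unfold twoTime
  rw [level_mv_pow hpL hμ hμ1 t φ, Fintype.sum_prod_type]
  refine sum_eq_zero fun l _ => ?_
  have h : ∀ y, pL (l, y).1 * μ (l, y).2 * ε (l, y) * mv (imhMatrix pL qL ^ t) φ (l, y).1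
      = pL l * mv (imhMatrix pL qL ^ t) φ l * (μ y * ε (l, y)) := fun y => by ring
  rw [sum_congr rfl fun y _ => h y, ← mul_sum, hε l, mul_zero]

/-- Residual/residual: `S_t(ε, ε) = Σ_l pL l · (liuG pL qL l l)ᵗ · Σ_y μ y ε (l, y)²` — the
stationary probability of `t` consecutive rejections weighted by the conditional variance. -/
theorem twoTime_resid (hpL : ∀ l, 0 < pL l) (hμ : ∀ y, 0 < μ y) (hμ1 : ∑ y, μ y = 1)
    {ε : L × Y → ℝ} (hε : ∀ l, ∑ y, μ y * ε (l, y) = 0) (t : ℕ) :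
    twoTime (fun z : L × Y => pL z.1 * μ z.2)
        (imhMatrix (fun z : L × Y => pL z.1 * μ z.2) (fun z => qL z.1 * μ z.2)) t ε ε
      = ∑ l, pL l * liuG pL qL l l ^ t * ∑ y, μ y * ε (l, y) ^ 2 := by
  unfold twoTime
  rw [resid_mv_pow hpL hμ hμ1 hε t, Fintype.sum_prod_type]
  refine sum_congr rfl fun l _ => ?_
  rw [mul_sum]
  exact sum_congr rfl fun y _ => by ring

/-! ### (T3), general form: the level decomposition -/

/-- **`S_t(φ ∘ fst + ε, φ ∘ fst + ε) = S^L_t(φ, φ) + Σ_l pL l (1 − a l)ᵗ v l`** for a level function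
`φ` and a level-wise centred residual `ε` (`v l = Σ_y μ y ε (l, y)²`): the cross terms vanish. -/
theorem twoTime_level_add_resid (hpL : ∀ l, 0 < pL l) (hμ : ∀ y, 0 < μ y) (hμ1 : ∑ y, μ y = 1)
    (φ : L → ℝ) {ε : L × Y → ℝ} (hε : ∀ l, ∑ y, μ y * ε (l, y) = 0) (t : ℕ) :
    twoTime (fun z : L × Y => pL z.1 * μ z.2)
        (imhMatrix (fun z : L × Y => pL z.1 * μ z.2) (fun z => qL z.1 * μ z.2)) t
        (fun z => φ z.1 + ε z) (fun z => φ z.1 + ε z)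
      = twoTime pL (imhMatrix pL qL) t φ φ
        + ∑ l, pL l * liuG pL qL l l ^ t * ∑ y, μ y * ε (l, y) ^ 2 := by
  have hf : (fun z : L × Y => φ z.1 + ε z) = (fun z : L × Y => φ z.1) + ε := by
    funext z; simp
  rw [hf, twoTime_add_add, twoTime_level hpL hμ hμ1 φ φ t, twoTime_level_resid hpL hμ hμ1 φ hε t,
    twoTime_resid_level hpL hμ hμ1 hε φ t, twoTime_resid hpL hμ hμ1 hε t]
  ring

/-- **IMH-LAW (T3), general form.**  For EVERY observable `f` on `level × label`, with level mean
`φ l = Σ_y μ y f (l, y)` and residual `f − φ ∘ fst`: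
`S_t(f, f) = S^L_t(φ, φ) + Σ_l pL l · (liuG pL qL l l)ᵗ · Σ_y μ y (f (l, y) − φ l)²` — the
autocovariance of `f` under the exact chain is the level mean's autocovariance under the weight
process (itself the IMH chain `imhMatrix pL qL`) PLUS the conditional variance weighted by the
probability of `t` consecutive rejections. -/
theorem twoTime_level_decomposition (hpL : ∀ l, 0 < pL l) (hμ : ∀ y, 0 < μ y)
    (hμ1 : ∑ y, μ y = 1) (f : L × Y → ℝ) (t : ℕ) :
    twoTime (fun z : L × Y => pL z.1 * μ z.2)
        (imhMatrix (fun z : L × Y => pL z.1 * μ z.2) (fun z => qL z.1 * μ z.2)) t f f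
      = twoTime pL (imhMatrix pL qL) t (fun l => ∑ y, μ y * f (l, y)) (fun l => ∑ y, μ y * f (l, y))
        + ∑ l, pL l * liuG pL qL l l ^ t * ∑ y, μ y * (f (l, y) - ∑ y', μ y' * f (l, y')) ^ 2 := by
  have hε : ∀ l, ∑ y, μ y * (f (l, y) - ∑ y', μ y' * f (l, y')) = 0 :=
    levelMean_resid_centred hμ1 f
  have hf : (fun z : L × Y => (∑ y, μ y * f (z.1, y)) + (f z - ∑ y', μ y' * f (z.1, y'))) = f := by
    funext z; ring
  conv_lhs => rw [← hf]
  exact twoTime_level_add_resid hpL hμ hμ1 (fun l => ∑ y, μ y * f (l, y)) hε t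

end Level

end Summit.Ventures.LatticeQCDFlow.Scoring
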